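import Summits.Ventures.PackingBounds.ThreePointCert.C7QAgg1
import Summits.Ventures.PackingBounds.ThreePointCert.CheckFastFZ

/-!
# A(7, arccos 1/4) ≤ 35: kernel validation of the blocks of (i') and of the `FI` expansion (part 3)

Framing: lottery ticket; floor = certified bounds/negative ranges. Venture `PackingBounds` (cell
`pub-packcert`), three-point SDP family. Integer data of a feasible point of the Bachoc–Vallentin
semidefinite program (n = 7, s = 1/4, degree d = 10, Bachoc–Vallentin
multiplier set = cell mode sym2), derived by `cert2lean_s2.py` (sdp gen 5 fork of cert2lean_lp.py) from the exact rational certificate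
`sdp-d7-deg10-s14-sym2-lp-v1.json` of the cell (exact verifier #1 + verifier #2 of the other seat), in the units of the kernel
checker `ThreePointCert.Check` + `CheckSym2` (soundness `card_le_of_cert3S2`); Gram factors offset-encoded for the
Kronecker-packed chunk validation `ThreePointCert.CheckKron` (emitter `emitleanS2.py` = lp gen 3 emitleanK.py). Generated file: plain
lists of integers / monomials.
-/

namespace Summit.Ventures.PackingBounds.ThreePointCert.C7Q

open Literature.Geometry.DiscreteGeometry Literature.Geometry.DiscreteGeometry.PolyCert PolyCert.SPoly

set_option maxRecDepth 100000 in
set_option maxHeartbeats 0 in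
/-- `FI` expansion, blocks [6] (kernel, Gram form + sorted-merge zero test). -/
theorem okF_7 : FchunkOKZ C7Q.cert.n C7Q.cert.d [FBlk.mk 6 C7Q.fw6] C7Q.dFc6 C7Q.dFc7 = true := by
  decide +kernel

set_option maxRecDepth 100000 in
set_option maxHeartbeats 0 in
/-- `FI` expansion, blocks [7] (kernel, Gram form + sorted-merge zero test). -/
theorem okF_8 : FchunkOKZ C7Q.cert.n C7Q.cert.d [FBlk.mk 7 C7Q.fw7] C7Q.dFc7 C7Q.dFc8 = true := by
  decide +kernel

set_option maxRecDepth 100000 in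
set_option maxHeartbeats 0 in
/-- `FI` expansion, blocks [8, 9, 10] (kernel, Gram form + sorted-merge zero test). -/
theorem okF_9 : FchunkOKZ C7Q.cert.n C7Q.cert.d [FBlk.mk 8 C7Q.fw8, FBlk.mk 9 C7Q.fw9, FBlk.mk 10 C7Q.fw10] C7Q.dFc8 C7Q.eFP = true := by
  decide +kernel

end Summit.Ventures.PackingBounds.ThreePointCert.C7Q
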